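import Literature.NumberTheory.Automorphic.CuspidalCohomologyGL
import Mathlib.RepresentationTheory.Homological.GroupCohomology.LowDegree
import Mathlib.RepresentationTheory.Homological.GroupCohomology.Functoriality
import HarnessLib

/-!
# `H¹(S_L, Ṽ)` through `1`-cocycles, and the cocycle of an equivariant primitive
# (the algebraic skeleton of the Eichler–Shimura–Harder map in degree one)

Topic `NumberTheory/Automorphic`; namespace `Literature.NumberTheory.Automorphic.TwistedQuotient`
(the generic layer of `CuspidalCohomologyGL.lean`: `ι : Γ →* 𝒢`, a level `L ≤ 𝒢`, twisted
coefficients `ρ : Γ → GL(V)`, `H^q(S_L, Ṽ) = H^q(Γ, Fun(𝒢 ⧸ L, V))` = Mathlib `groupCohomology`,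
Hecke operators `TwistedQuotient.heckeEnd`).  Definitions with bodies and theorems only; no named
fact, no `sorry`.

## 1. Degree one through cocycles (Mathlib plumbing)

Mathlib's `groupCohomology.H1 A` is by definition `groupCohomology A 1`, with the quotient map
`H1π : Z¹(Γ, A) → H¹` from the inhomogeneous `1`-cocycles
`Z¹ = {c : Γ → A | c (γ δ) = γ • c δ + c γ}` (`mem_cocycles₁_iff`), kernel the coboundaries
`{γ ↦ γ • m − m}` (`H1π_eq_zero_iff`), natural in `A` (`H1π_comp_map`).  For `A = Fun(𝒢 ⧸ L, V)`:

* `cocycleClass ι L ρ c ∈ H¹(S_L, Ṽ)` — the class of a `1`-cocycle `c`;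
* `cocycleClass_eq_zero_iff` — it vanishes iff `c γ = γ • m − m` for one `m : 𝒢 ⧸ L → V`;
* `heckeEnd_one_cocycleClass` — `T_g [c] = [T_g ∘ c]` (`T_g = [L g L]` acts on cocycles valuewise,
  `ArithmeticQuotient.heckeFun`), and `heckeEnd_one_cocycleClass_eq_smul` — if `T_g ∘ c − a c` is a
  coboundary then `T_g [c] = a [c]`.

## 2. The cocycle of an equivariant primitive [cite: BorelWallach2000, VII §2.2–2.7]

This is the algebra underneath the classical construction of cohomology classes of arithmetic
groups from closed invariant differential forms / `(𝔤, K_∞)`-cocycles (Matsushima, van Est,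
Borel–Wallach VII §2; for `GL₂`: the Eichler–Shimura(–Harder) integral
[cite: Harder1987, §3]).  Let `P` be ANY `k[Γ]`-module (in the application: all `V`-valued
functions on `G_∞ × 𝒢 ⧸ L`, `(γ • F)(x, c) = ρ(γ) F(γ_∞⁻¹ x, γ_f⁻¹ c)`) and
`j : Fun(𝒢 ⧸ L, V) → P` an injective `Γ`-map (the functions constant in the archimedean variable).
Call `F ∈ P` a PRIMITIVE when every `γ • F − F` is a constant, `∈ range j` (in the application:
`F` is a primitive `dF = ω` of a closed `Γ`-INVARIANT `V`-valued form `ω`, so `d(γ • F − F) = 0`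
and `γ • F − F` is constant because the symmetric space is connected).  Then

* `primitiveCocycle` — `c_F γ := j⁻¹ (γ • F − F)` is a `1`-cocycle (`j (c_F γ) = γ • F − F`,
  `j_primitiveCocycle`), and `primitiveClass … F ∈ H¹(S_L, Ṽ)` is its class;
* `primitiveClass_eq_zero_iff` — `[c_F] = 0` iff `F − j m` is `Γ`-FIXED for some constant `m`
  (i.e. iff `ω` has a `Γ`-invariant primitive): the injectivity statement one proves analytically
  (Borel: a cuspidal harmonic form has no invariant primitive of moderate growth);
  `primitiveClass_add_apply` — `[c_{F + j m}] = [c_F]` (independence of the primitive);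
* `heckeEnd_one_primitiveClass_eq_smul` — HECKE: if an endomorphism `T` of `P` commutes with `Γ`,
  restricts to `[L g L]` on the constants (`T ∘ j = j ∘ heckeFun g`) and `T F − a F` is constant
  (in the application: `ω` is a `T_g`-eigenform with eigenvalue `a`, so `T F − a F` has zero
  differential), then `T_g [c_F] = a [c_F]`.

Nothing analytic is used or assumed here; the van Est / de Rham theorems themselves
(`H•(Γ, Fun(𝒢⧸L, V)) ≅ H•_{dR}`) are NOT proved — only the degree-one map and its two formal
properties, which is what an existence proof of eigenclasses needs.

## References

* A. Borel, N. Wallach, *Continuous cohomology, discrete subgroups, and representations of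
  reductive groups*, 2nd ed., AMS (2000), VII §2.2–2.7. [BorelWallach2000]
* G. Harder, *Eisenstein cohomology of arithmetic groups. The case GL₂*, Invent. Math. 89
  (1987), §3. [Harder1987]
-/

noncomputable section

open CategoryTheory groupCohomology

universe u

namespace Literature.NumberTheory.Automorphic

namespace TwistedQuotient

variable {k : Type u} [CommRing k] {Γ 𝒢 : Type u} [Group Γ] [Group 𝒢]
  (ι : Γ →* 𝒢) (L : Subgroup 𝒢) {V : Type u} [AddCommGroup V] [Module k V]
  (ρ : Representation k Γ V)

/-! ### 1. `H¹(S_L, Ṽ)` through `1`-cocycles -/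

section Cocycles

/-- The representation underlying `coeffRep ι L ρ` is `coeffRepresentation ι L ρ`. [folklore] -/
@[simp]
theorem coeffRep_ρ : (coeffRep ι L ρ).ρ = coeffRepresentation ι L ρ := rfl

/-- **The class `[c] ∈ H¹(S_L, Ṽ)` of a `1`-cocycle** `c : Γ → Fun(𝒢 ⧸ L, V)`,
`c (γ δ) = γ • c δ + c γ` (Mathlib `groupCohomology.H1π`; `H¹ = groupCohomology _ 1` by
definition). [folklore] -/
def cocycleClass (c : cocycles₁ (coeffRep ι L ρ)) : cohomology ι L ρ 1 :=
  (H1π (coeffRep ι L ρ)).hom c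

/-- `[c]` is additive in `c`. [folklore] -/
theorem cocycleClass_add (c c' : cocycles₁ (coeffRep ι L ρ)) :
    cocycleClass ι L ρ (c + c') = cocycleClass ι L ρ c + cocycleClass ι L ρ c' :=
  map_add _ c c'

/-- `[c]` is subtractive in `c`. [folklore] -/
theorem cocycleClass_sub (c c' : cocycles₁ (coeffRep ι L ρ)) :
    cocycleClass ι L ρ (c - c') = cocycleClass ι L ρ c - cocycleClass ι L ρ c' :=
  map_sub _ c c'

/-- `[a • c] = a • [c]`. [folklore] -/
theorem cocycleClass_smul (a : k) (c : cocycles₁ (coeffRep ι L ρ)) :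
    cocycleClass ι L ρ (a • c) = a • cocycleClass ι L ρ c :=
  map_smul _ a c

/-- Every class in `H¹(S_L, Ṽ)` is the class of a `1`-cocycle. [folklore] -/
theorem cocycleClass_surjective : Function.Surjective (cocycleClass ι L ρ) := by
  intro x
  induction x using H1_induction_on with
  | h c => exact ⟨c, rfl⟩

/-- **`[c] = 0` iff `c` is a coboundary**, `c γ = γ • m − m` for one `m : 𝒢 ⧸ L → V`
(`γ • m = ρ(γ) ∘ m ∘ (ι γ)⁻¹`). [folklore] -/
theorem cocycleClass_eq_zero_iff (c : cocycles₁ (coeffRep ι L ρ)) :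
    cocycleClass ι L ρ c = 0 ↔
      ∃ m : 𝒢 ⧸ L → V, ∀ γ, coeffRepresentation ι L ρ γ m - m = c γ := by
  rw [cocycleClass, H1π_eq_zero_iff]
  constructor
  · rintro ⟨m, hm⟩
    refine ⟨m, fun γ => ?_⟩
    have h := congr_fun hm γ
    rwa [d₀₁_hom_apply] at h
  · rintro ⟨m, hm⟩
    refine ⟨m, funext fun γ => ?_⟩
    rw [d₀₁_hom_apply]
    exact hm γ

/-- The values of the cocycle `T_g ∘ c` (image of `c` under the Hecke correspondence acting on
the coefficients `Fun(𝒢 ⧸ L, V)`). [folklore] -/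
theorem mapCocycles₁_heckeRepHom_apply (g : 𝒢) (c : cocycles₁ (coeffRep ι L ρ)) (γ : Γ) :
    mapCocycles₁.{u, u} (A := coeffRep ι L ρ) (B := coeffRep ι L ρ) (MonoidHom.id Γ)
        (heckeRepHom ι L ρ g) c γ =
      ArithmeticQuotient.heckeFun k L g V (c γ) := by
  rw [coe_mapCocycles₁]
  simp only [cochainsMap₁, MonoidHom.id_apply, ModuleCat.hom_ofHom, LinearMap.coe_comp,
    Function.comp_apply, LinearMap.funLeft_apply, LinearMap.compLeft_apply]
  rfl

/-- **`T_g [c] = [T_g ∘ c]`**: the Hecke operator `[L g L]` on `H¹(S_L, Ṽ)` (functoriality of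
group cohomology in the coefficients) is computed on cocycles valuewise.
[cite: BorelWallach2000, VII §2.2] -/
theorem heckeEnd_one_cocycleClass (g : 𝒢) (c : cocycles₁ (coeffRep ι L ρ)) :
    heckeEnd ι L ρ g 1 (cocycleClass ι L ρ c) =
      cocycleClass ι L ρ (mapCocycles₁.{u, u} (A := coeffRep ι L ρ) (B := coeffRep ι L ρ)
        (MonoidHom.id Γ) (heckeRepHom ι L ρ g) c) := by
  have h := H1π_comp_map.{u} (A := coeffRep ι L ρ) (B := coeffRep ι L ρ) (MonoidHom.id Γ)
    (heckeRepHom ι L ρ g)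
  apply_fun (fun f => f.hom c) at h
  simp only [ModuleCat.hom_comp, LinearMap.comp_apply] at h
  unfold cocycleClass
  exact h

/-- **Eigen-cocycles give eigenclasses**: if `T_g ∘ c − a • c` is a coboundary then
`T_g [c] = a • [c]`. [folklore] -/
theorem heckeEnd_one_cocycleClass_eq_smul {g : 𝒢} {c : cocycles₁ (coeffRep ι L ρ)} {a : k}
    (h : ∃ m : 𝒢 ⧸ L → V, ∀ γ, coeffRepresentation ι L ρ γ m - m =
      ArithmeticQuotient.heckeFun k L g V (c γ) - a • c γ) :
    heckeEnd ι L ρ g 1 (cocycleClass ι L ρ c) = a • cocycleClass ι L ρ c := by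
  rw [heckeEnd_one_cocycleClass, ← sub_eq_zero, ← cocycleClass_smul, ← cocycleClass_sub,
    cocycleClass_eq_zero_iff]
  obtain ⟨m, hm⟩ := h
  exact ⟨m, fun γ => by rw [hm γ]; rfl⟩

end Cocycles

/-! ### 2. The `1`-cocycle of an equivariant primitive -/

section Primitive

variable {P : Type*} [AddCommGroup P] [Module k P] (σ : Representation k Γ P)
  {M : Type*} [AddCommGroup M] [Module k M] (j : M →ₗ[k] P)

/-- `F ∈ P` is a **primitive** (relative to the constants `j : Fun(𝒢 ⧸ L, V) ↪ P`): every
`γ • F − F` is a constant.  (For `P` the smooth `V`-valued functions on `G_∞ × 𝒢 ⧸ L` and `F` a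
primitive of a closed `Γ`-invariant form this is "`d(γ • F − F) = 0` and the symmetric space is
connected".) [cite: BorelWallach2000, VII §2.2] -/
def IsPrimitive (F : P) : Prop :=
  ∀ γ : Γ, σ γ F - F ∈ LinearMap.range j

variable {σ j}

/-- The values `c_F γ` of the cocycle of a primitive: SOME constant with `j (c_F γ) = γ • F − F`
(unique when `j` is injective, `eq_primitiveCocycleFun`). [cite: BorelWallach2000, VII §2.2] -/
def primitiveCocycleFun {F : P} (hF : IsPrimitive σ j F) (γ : Γ) : M :=
  (hF γ).choose

/-- `j (c_F γ) = γ • F − F`. [cite: BorelWallach2000, VII §2.2] -/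
theorem j_primitiveCocycleFun {F : P} (hF : IsPrimitive σ j F) (γ : Γ) :
    j (primitiveCocycleFun hF γ) = σ γ F - F :=
  (hF γ).choose_spec

/-- Uniqueness of the values: `j m = γ • F − F` forces `m = c_F γ` (`j` injective). [folklore] -/
theorem eq_primitiveCocycleFun (hj : Function.Injective j) {F : P} (hF : IsPrimitive σ j F)
    {γ : Γ} {m : M} (hm : j m = σ γ F - F) : m = primitiveCocycleFun hF γ :=
  hj (by rw [hm, j_primitiveCocycleFun])

variable {j : ((𝒢 ⧸ L) → V) →ₗ[k] P}

/-- **`c_F` is a `1`-cocycle**: `c_F (γ δ) = γ • c_F δ + c_F γ`, because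
`γδ • F − F = γ • (δ • F − F) + (γ • F − F)` and `j` is an injective `Γ`-map.
[cite: BorelWallach2000, VII §2.2] -/
theorem primitiveCocycleFun_mem_cocycles₁ (hj : Function.Injective j)
    (hjσ : ∀ (γ : Γ) (m : (𝒢 ⧸ L) → V), j (coeffRepresentation ι L ρ γ m) = σ γ (j m))
    {F : P} (hF : IsPrimitive σ j F) :
    primitiveCocycleFun hF ∈ cocycles₁ (coeffRep ι L ρ) := by
  rw [mem_cocycles₁_iff]
  intro γ δ
  apply hj
  rw [map_add, coeffRep_ρ, hjσ, j_primitiveCocycleFun, j_primitiveCocycleFun,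
    j_primitiveCocycleFun, map_mul, map_sub]
  simp only [Module.End.mul_apply]
  abel

/-- **The `1`-cocycle `c_F` of a primitive `F`** (`j (c_F γ) = γ • F − F`).
[cite: BorelWallach2000, VII §2.2] -/
def primitiveCocycle (hj : Function.Injective j)
    (hjσ : ∀ (γ : Γ) (m : (𝒢 ⧸ L) → V), j (coeffRepresentation ι L ρ γ m) = σ γ (j m))
    {F : P} (hF : IsPrimitive σ j F) : cocycles₁ (coeffRep ι L ρ) :=
  ⟨primitiveCocycleFun hF, primitiveCocycleFun_mem_cocycles₁ ι L ρ hj hjσ hF⟩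

/-- The values of `primitiveCocycle`. [folklore] -/
@[simp]
theorem primitiveCocycle_apply (hj : Function.Injective j)
    (hjσ : ∀ (γ : Γ) (m : (𝒢 ⧸ L) → V), j (coeffRepresentation ι L ρ γ m) = σ γ (j m))
    {F : P} (hF : IsPrimitive σ j F) (γ : Γ) :
    primitiveCocycle ι L ρ hj hjσ hF γ = primitiveCocycleFun hF γ :=
  rfl

/-- `j (c_F γ) = γ • F − F` for the bundled cocycle. [cite: BorelWallach2000, VII §2.2] -/
theorem j_primitiveCocycle (hj : Function.Injective j)
    (hjσ : ∀ (γ : Γ) (m : (𝒢 ⧸ L) → V), j (coeffRepresentation ι L ρ γ m) = σ γ (j m))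
    {F : P} (hF : IsPrimitive σ j F) (γ : Γ) :
    j (primitiveCocycle ι L ρ hj hjσ hF γ) = σ γ F - F :=
  j_primitiveCocycleFun hF γ

/-- **The class `[c_F] ∈ H¹(S_L, Ṽ)` of the cocycle of a primitive** — the degree-one
van Est / Eichler–Shimura–Harder class of the closed invariant form of which `F` is a primitive.
[cite: BorelWallach2000, VII §2.2–2.7] [cite: Harder1987, §3] -/
def primitiveClass (hj : Function.Injective j)
    (hjσ : ∀ (γ : Γ) (m : (𝒢 ⧸ L) → V), j (coeffRepresentation ι L ρ γ m) = σ γ (j m))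
    {F : P} (hF : IsPrimitive σ j F) : cohomology ι L ρ 1 :=
  cocycleClass ι L ρ (primitiveCocycle ι L ρ hj hjσ hF)

/-- **`[c_F] = 0` iff the form has a `Γ`-invariant primitive**: the class of the cocycle of `F`
vanishes iff `F − j m` is fixed by `Γ` for some constant `m`. [cite: BorelWallach2000, VII §2.2] -/
theorem primitiveClass_eq_zero_iff (hj : Function.Injective j)
    (hjσ : ∀ (γ : Γ) (m : (𝒢 ⧸ L) → V), j (coeffRepresentation ι L ρ γ m) = σ γ (j m))
    {F : P} (hF : IsPrimitive σ j F) :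
    primitiveClass ι L ρ hj hjσ hF = 0 ↔ ∃ m : (𝒢 ⧸ L) → V, ∀ γ, σ γ (F - j m) = F - j m := by
  rw [primitiveClass, cocycleClass_eq_zero_iff]
  refine exists_congr fun m => forall_congr' fun γ => ?_
  rw [primitiveCocycle_apply, ← hj.eq_iff, map_sub, hjσ, j_primitiveCocycleFun, map_sub,
    sub_eq_sub_iff_sub_eq_sub, ← neg_sub (σ γ F) (σ γ (j m)), ← neg_sub F (j m), neg_inj]

/-- **Non-vanishing criterion**: if NO translate `F − j m` by a constant is `Γ`-fixed, the class
`[c_F]` is non-zero. [cite: BorelWallach2000, VII §2.2] -/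
theorem primitiveClass_ne_zero (hj : Function.Injective j)
    (hjσ : ∀ (γ : Γ) (m : (𝒢 ⧸ L) → V), j (coeffRepresentation ι L ρ γ m) = σ γ (j m))
    {F : P} (hF : IsPrimitive σ j F)
    (h : ∀ m : (𝒢 ⧸ L) → V, ∃ γ, σ γ (F - j m) ≠ F - j m) :
    primitiveClass ι L ρ hj hjσ hF ≠ 0 := by
  rw [Ne, primitiveClass_eq_zero_iff]
  rintro ⟨m, hm⟩
  obtain ⟨γ, hγ⟩ := h m
  exact hγ (hm γ)

/-- A constant translate `F + j m` of a primitive is a primitive. [folklore] -/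
theorem IsPrimitive.add_apply
    (hjσ : ∀ (γ : Γ) (m : (𝒢 ⧸ L) → V), j (coeffRepresentation ι L ρ γ m) = σ γ (j m))
    {F : P} (hF : IsPrimitive σ j F) (m : (𝒢 ⧸ L) → V) : IsPrimitive σ j (F + j m) := by
  intro γ
  obtain ⟨x, hx⟩ := hF γ
  refine ⟨x + (coeffRepresentation ι L ρ γ m - m), ?_⟩
  rw [map_add, map_sub, hx, hjσ, map_add]
  abel

/-- **Independence of the primitive**: `[c_{F + j m}] = [c_F]` — two primitives of the same form
differ by a constant and give cohomologous cocycles. [cite: BorelWallach2000, VII §2.2] -/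
theorem primitiveClass_add_apply (hj : Function.Injective j)
    (hjσ : ∀ (γ : Γ) (m : (𝒢 ⧸ L) → V), j (coeffRepresentation ι L ρ γ m) = σ γ (j m))
    {F : P} (hF : IsPrimitive σ j F) (m : (𝒢 ⧸ L) → V) :
    primitiveClass ι L ρ hj hjσ (hF.add_apply ι L ρ hjσ m) = primitiveClass ι L ρ hj hjσ hF := by
  rw [← sub_eq_zero, primitiveClass, primitiveClass, ← cocycleClass_sub, cocycleClass_eq_zero_iff]
  refine ⟨m, fun γ => hj ?_⟩
  change j _ = j (primitiveCocycleFun _ γ - primitiveCocycleFun _ γ)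
  simp only [map_sub, map_add, j_primitiveCocycleFun, hjσ]
  abel

/-- **Hecke equivariance of the primitive class.**  Let `T` be a `k`-linear endomorphism of `P`
commuting with `Γ` and restricting to the double-coset operator `[L g L]` on the constants
(`T ∘ j = j ∘ heckeFun g`).  If `T F − a • F` is a constant (in the application: the closed form
`dF` is a `T_g`-eigenform with eigenvalue `a`), then `T_g [c_F] = a • [c_F]` in `H¹(S_L, Ṽ)`.
[cite: BorelWallach2000, VII §2.2] [cite: Harder1987, §3] -/
theorem heckeEnd_one_primitiveClass_eq_smul (hj : Function.Injective j)
    (hjσ : ∀ (γ : Γ) (m : (𝒢 ⧸ L) → V), j (coeffRepresentation ι L ρ γ m) = σ γ (j m))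
    {F : P} (hF : IsPrimitive σ j F) {g : 𝒢} {T : P →ₗ[k] P} {a : k}
    (hTσ : ∀ (γ : Γ) (x : P), T (σ γ x) = σ γ (T x))
    (hTj : ∀ m : (𝒢 ⧸ L) → V, T (j m) = j (ArithmeticQuotient.heckeFun k L g V m))
    (hTF : T F - a • F ∈ LinearMap.range j) :
    heckeEnd ι L ρ g 1 (primitiveClass ι L ρ hj hjσ hF) =
      a • primitiveClass ι L ρ hj hjσ hF := by
  obtain ⟨m₀, hm₀⟩ := hTF
  refine heckeEnd_one_cocycleClass_eq_smul ι L ρ ⟨m₀, fun γ => hj ?_⟩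
  rw [primitiveCocycle_apply]
  simp only [map_sub, map_smul, hjσ, hm₀, ← hTj, j_primitiveCocycleFun, hTσ, smul_sub]
  abel

end Primitive

end TwistedQuotient

end Literature.NumberTheory.Automorphic

end
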